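import Literature.Topology.FourManifolds.FreeFundamentalGroupThreeManifold
import Literature.Topology.FourManifolds.SPC4HandlesThmAGenusZero
import Literature.Topology.FourManifolds.SPC4HandlesTwoLeaves
import Literature.Topology.FourManifolds.SPC4Wave0
import Literature.Topology.FourManifolds.OneHandlebodyBoundaryCarrier
import Literature.Topology.FourManifolds.OneHandlebodyFundamentalGroup
import Literature.Topology.FourManifolds.SPC4HandlesLemma2Direct
import Literature.Topology.FourManifolds.BoundaryOrientation
import Literature.Topology.FourManifolds.ThickenedHandlebodyFour
import Literature.Topology.FourManifolds.LickorishWallace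
import Literature.AlgebraicTopology.FundamentalGroup.SphereCoreComplementPi1
import Literature.Topology.FourManifolds.GluckTwistMeridian
import Literature.Topology.FourManifolds.KirbyCalculus
import Literature.Topology.FourManifolds.HomotopyS4CompactProofs
import Literature.Topology.FourManifolds.SphereTwoProdCircleSumUniqueness
import Mathlib.Topology.Instances.Shrink
import HarnessLib

/-!
# `#ᵏ(S¹ × S²)` from free `π₁`: what is proved, and the genus-zero slice is Perelman's theorem

Topic `Literature/Topology/FourManifolds`; proofs companion of
`FreeFundamentalGroupThreeManifold.lean`, whose single named fact
`Literature.Topology.FourManifolds.diffeomorph_sumS1S2_of_isFreeOfRank_fundamentalGroup`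
(Kneser–Stallings–Perelman, in the derivation printed by Abrams–Gay–Kirby (2018), p. 4; Hempel
(1976), Thm. 5.2, 5.3 and Thm. 7.1) says: a closed connected orientable smooth `3`-manifold `Y`
with `π₁(Y, y)` free of rank `k` is diffeomorphic to the boundary `bV.carrier` of EVERY compact
connected orientable smooth `4`-dimensional handlebody `V` with one `0`-handle and `k`
`1`-handles (`V ≅ ♮ᵏ S¹ × B³`, `∂V ≅ #ᵏ S¹ × S²`).  **Everything here is proved; no definition
and no named fact is introduced; the fact is not discharged.**  What lands:

* §1 `π₁` free of rank `0` ⟺ simply connected (`IsFreeOfRank.subsingleton`,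
  `isFreeOfRank_zero_iff_subsingleton`, `isFreeOfRank_fundamentalGroup_zero`,
  `simplyConnectedSpace_of_isFreeOfRank_fundamentalGroup_zero` for connected charted spaces —
  Hatcher Prop. 1.5: path connected with `π₁ = 1` at one point), and independence of the base
  point (`IsFreeOfRank.fundamentalGroup_of_pathConnectedSpace`).
* §2 **The "every `V`" in the fact costs nothing**: the boundaries of any two compact connected
  orientable `4`-dimensional handlebodies of the same type `(1, k)` (same universe) are
  diffeomorphic (`nonempty_diffeomorph_boundary_of_handleCount_one`) — the tree's DISCHARGED
  classification UNIQ₄ (`nonempty_diffeomorph_of_hasHandleDecomposition_handleCount_one_holds`,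
  Kosinski (1993), VI (11.4)(c)) restricted to boundary data (`BoundaryData.restrictDiffeomorph`,
  Lee Thm. 5.11); hence the fact follows from its instance at ONE model `V₀` per `k`
  (`nonempty_diffeomorph_boundary_of_model`), and in genus `0` every such boundary is `𝕊³`
  (`nonempty_diffeomorph_boundary_sphere_of_handleCount_one_zero`: `V ≅ ULift 𝔻⁴`,
  `∂𝔻⁴ = 𝕊³`; Kirby (1989), Ch. I §2, p. 8, `k = 0`).
* §3 **The genus-zero slice of the fact is exactly the Poincaré conjecture** in the tree's smooth
  form spc4.S31 `Literature.Topology.FourManifolds.nonempty_diffeomorph_sphere_three` (Perelman;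
  Morgan–Tian (2007), Cor. 0.2 (a)), in every universe:
  `diffeomorph_sumS1S2_of_isFreeOfRank_fundamentalGroup_zero_of_sphere_three` (S31 ⟹ slice,
  even without the orientability hypothesis), `nonempty_diffeomorph_sphere_three_of_genusZero`
  (slice ⟹ S31: a closed simply connected `M` is connected, orientable — Lee Thm. 15.43,
  `isOrientable_of_simplyConnectedSpace_holds` — and has `π₁` free of rank `0`, so it is
  diffeomorphic to `∂(ULift 𝔻⁴) ≅ 𝕊³`), the `iff`
  `diffeomorph_sumS1S2_of_isFreeOfRank_fundamentalGroup_zero_iff_sphere_three`, and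
  **`nonempty_diffeomorph_sphere_three_of_diffeomorph_sumS1S2`: the fact implies Perelman's
  theorem.**  This is Abrams–Gay–Kirby's "Perelman's proof of the 3-dimensional Poincaré
  conjecture … shows that no connected summand has trivial fundamental group" read at `k = 0`,
  and it certifies that the fact cannot be discharged before spc4.S31 is.
* §4 (appended) **Non-vacuity in every genus**: the boundary of a compact connected (orientable)
  `4`-dimensional handlebody of type `(1, k)` is a closed connected (orientable) `3`-manifold with
  `π₁` free of rank `k` (`π₁(V) ≅ F_k`, Matsumoto §5.3, and `π₁(∂V) ≅ π₁(V)`, Laudenbach–Poénaru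
  p. 339, both proved in the tree; Kosinski VI (11.5)); such `V` exist
  (`exists_oneHandlebody_four`), so the hypothesis class of the fact is inhabited for every `k`
  (`exists_isFreeOfRank_fundamentalGroup_closedThreeManifold`), and on these instances the fact
  holds by §2 (`diffeomorph_sumS1S2_of_isFreeOfRank_fundamentalGroup_of_boundary`).
* §5 (appended) **The fact is a statement about closed `3`-manifolds only**: it is EQUIVALENT, in
  every universe, to "closed connected orientable smooth `3`-manifolds with `π₁` free of the same
  rank are diffeomorphic" (`diffeomorph_sumS1S2_of_isFreeOfRank_fundamentalGroup_iff_classification`;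
  ⟹ through the lifted models of §4, ⟸ because `∂V` is such a manifold) — Hempel 5.3 with
  Perelman, no `4`-manifold left in it.
* §6 (appended) **Universe lowering**: the classification, hence the fact, over `Type` implies it
  in every universe (`nonempty_diffeomorph_of_isFreeOfRank_of_univ_zero`,
  `diffeomorph_sumS1S2_of_isFreeOfRank_fundamentalGroup_of_univ_zero`: transport the smooth
  structure to `Shrink.{0} Y`, as in `nonempty_diffeomorph_sphere_three_of_univ_zero`), so a proof
  over `Y : Type`, where the tree's connected-sum calculus lives, discharges the fact as stated.
* §7 (appended) **The two remaining leaves, in the tree's `Type`-level vocabulary**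
  (`diffeomorph_sumS1S2_of_isFreeOfRank_fundamentalGroup_of_leaves`, both as explicit hypotheses,
  nothing vendored): (H53) Hempel 5.3 + Perelman, "closed connected orientable `M : Type` with
  `π₁ ≅ F_k` satisfies `IsSphereTwoProdCircleSum k M`" (for `k = 0` this is spc4.S31 over `Type`),
  and (HU) "`#ᵏ(S² × S¹)` is well defined: two manifolds with `IsSphereTwoProdCircleSum k` are
  diffeomorphic" (Kervaire–Milnor Lemma 2.1, Palais–Cerf) ⟹ the fact in every universe.
* §8 (appended) **(HU) is a theorem** (`IsSphereTwoProdCircleSum.nonempty_diffeomorph`,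
  `SphereTwoProdCircleSumUniqueness.lean`: unoriented disc theorem + the orientation-reversing
  symmetry of `S² × S¹`), so **the fact, in every universe, follows from (H53) alone**
  (`diffeomorph_sumS1S2_of_isFreeOfRank_fundamentalGroup_of_hempel`), as does spc4.S31
  (`nonempty_diffeomorph_sphere_three_of_hempel`); and the `k = 0` instance of (H53) is S31 over
  `Type` (`isSphereTwoProdCircleSum_zero_of_sphere_three`).  Net: the named fact is Hempel's
  Thm. 5.3 for closed orientable manifolds with Perelman's theorem, in the tree's `Type`-level
  connected-sum vocabulary — nothing `4`-dimensional and no well-definedness issue remains.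

## What is NOT here (the residue for `k ≥ 1`)

With §2 the fact is the conjunction of (i) the `3`-manifold theorem "closed orientable `Y` with
`π₁(Y) ≅ F_k` is `#ᵏ(S¹ × S²)`" — Kneser's conjecture (Stallings; Hempel Thm. 7.1), the prime
orientable closed `3`-manifolds with `π₁ ≅ ℤ` (Hempel Thm. 5.2: the Sphere Theorem, Hurewicz,
Whitehead) and Perelman for the simply connected summands (Hempel 5.3; spc4.S31) — none of which
is in the tree beyond spc4.S31 and `π₁(#ⁿ(S² × S¹)) ≅ F_n`
(`IsSphereTwoProdCircleSum.nonempty_mulEquiv_freeGroup`, `SphereTwoProdCircleSumFundamentalGroup.lean`),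
and (ii) the identification of the boundary of ONE model `1`-handlebody of type `(1, k)` (e.g.
the solid bodies `{q(x, y) + z² + w² ≤ c} ⊂ ℝ⁴` of `ThickenedHandlebodyFour.lean`) with
`#ᵏ(S¹ × S²)` (Kirby (1989), Ch. I §2, p. 8), also absent.  Neither is asserted here.  By §5
the pair (i) + (ii) may be traded for (i) in the two-manifold form "same free rank ⟹
diffeomorphic", i.e. for the hypotheses (H53) and (HU) of §7, both over `Type` (§6); and (HU) is
proved (§8), so exactly (H53) — Hempel 5.3 + Perelman over `Type` — remains.

## References

* A. Abrams, D. Gay, R. Kirby, *Group trisections and smooth 4-manifolds*, Geom. Topol. 22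
  (2018) 1537–1545 = arXiv:1605.06731, p. 4 (proof of Thm. 5; read: `lit read
  arxiv:1605.06731`, p0004). [AbramsGayKirby2018]
* J. Hempel, *3-Manifolds*, Ann. of Math. Studies 86 (1976), Thm. 5.2, 5.3, Thm. 7.1. [Hempel1976]
* J. Morgan, G. Tian, *Ricci flow and the Poincaré conjecture* (2007), Cor. 0.2 (a). [MorganTian2007]
* A. A. Kosinski, *Differential Manifolds* (1993), VI (11.4)(c). [Kosinski1993]
* R. C. Kirby, *The topology of 4-manifolds*, LNM 1374 (1989), Ch. I §2, p. 8. [Kirby1989]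
* J. M. Lee, *Introduction to Smooth Manifolds* (2013), Thm. 5.11, Thm. 15.43. [LeeSmoothManifolds2013]
* M. Kervaire, J. Milnor, *Groups of homotopy spheres I*, Ann. of Math. 77 (1963), Lemma 2.1.
  [KervaireMilnor1963]
* M. W. Hirsch, *Differential Topology* (1976), §4.4, p. 101 (pullback orientations). [HirschDT1976]
* A. Hatcher, *Algebraic Topology* (2002), Prop. 1.5, Prop. 1.14. [HatcherAT2002]

## Design notes

* Only theorems; the genus-zero slice of the fact is written out inside the statements of §3 (no
  `def … : Prop` for it), as in `SPC4HandlesThmAGenusZero.lean`.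
* The model of type `(1, 0)` in universe `u` is `ULift 𝔻⁴` with boundary datum
  `(closedBallBoundaryData 3).ulift` (carrier `ULift 𝕊³ ≅ 𝕊³`, `ManifoldULift.diffeomorph`),
  exactly as in `BoundaryData.diffeoExtends_of_handleCount_one_zero_of_cerf`.
-/

open scoped Manifold ContDiff Topology
open Set Function Metric

noncomputable section

namespace Literature.Topology.FourManifolds

universe u

/-! ### §1 `π₁` free of rank `0` ⟺ simply connected -/

/-- A group free of rank `0` is trivial: `F₀ = FreeGroup (Fin 0)` is the trivial group (the free
group on the empty type). [folklore] -/
theorem IsFreeOfRank.subsingleton {G : Type*} [Group G] (h : IsFreeOfRank G 0) :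
    Subsingleton G := by
  obtain ⟨e⟩ := h
  exact e.symm.toEquiv.subsingleton

/-- **Free of rank `0` ⟺ trivial** (with the tree's `isFreeOfRank_zero_of_subsingleton`,
`GroupTrisections.lean`). [folklore] -/
theorem isFreeOfRank_zero_iff_subsingleton {G : Type*} [Group G] :
    IsFreeOfRank G 0 ↔ Subsingleton G :=
  ⟨IsFreeOfRank.subsingleton, fun _ => isFreeOfRank_zero_of_subsingleton G⟩

/-- The fundamental group of a simply connected space is free of rank `0` (it is trivial).
[folklore] -/
theorem isFreeOfRank_fundamentalGroup_zero {Y : Type*} [TopologicalSpace Y]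
    [SimplyConnectedSpace Y] (y : Y) : IsFreeOfRank (FundamentalGroup Y y) 0 :=
  isFreeOfRank_zero_of_subsingleton _

/-- Freeness of a given rank of `π₁(Y, y)` does not depend on the base point of the path
connected space `Y` (change of base point, Hatcher Prop. 1.5). [cite: HatcherAT2002, Prop. 1.5] -/
theorem IsFreeOfRank.fundamentalGroup_of_pathConnectedSpace {Y : Type*} [TopologicalSpace Y]
    [PathConnectedSpace Y] {y : Y} {k : ℕ} (h : IsFreeOfRank (FundamentalGroup Y y) k) (y' : Y) :
    IsFreeOfRank (FundamentalGroup Y y') k :=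
  h.of_mulEquiv (FundamentalGroup.fundamentalGroupMulEquivOfPathConnected y y')

/-- **A connected manifold with `π₁` free of rank `0` at one point is simply connected**: a
charted space over a real model with corners is locally path connected
(`locallyPathConnectedSpace_of_modelWithCorners`), so connected implies path connected, and a
path connected space with trivial fundamental group at one point is simply connected (Hatcher,
*Algebraic Topology* (2002), Prop. 1.5; `VanKampen.simplyConnectedSpace_of_subsingleton`).
[cite: HatcherAT2002, Prop. 1.5] -/
theorem simplyConnectedSpace_of_isFreeOfRank_fundamentalGroup_zero {E H : Type*}
    [NormedAddCommGroup E] [NormedSpace ℝ E] [TopologicalSpace H] (I : ModelWithCorners ℝ E H)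
    {Y : Type*} [TopologicalSpace Y] [ChartedSpace H Y] [ConnectedSpace Y] {y : Y}
    (h : IsFreeOfRank (FundamentalGroup Y y) 0) : SimplyConnectedSpace Y := by
  haveI := locallyPathConnectedSpace_of_modelWithCorners I Y
  haveI : PathConnectedSpace Y := pathConnectedSpace_iff_connectedSpace.mpr ‹_›
  haveI : Subsingleton (FundamentalGroup Y y) := h.subsingleton
  exact Literature.AlgebraicTopology.FundamentalGroup.VanKampen.simplyConnectedSpace_of_subsingleton y

/-! ### §2 The boundary of an orientable `4`-dimensional `1`-handlebody depends only on `k` -/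

/-- **Boundaries of compact connected orientable `4`-dimensional handlebodies of the same type
`(1, k)` are diffeomorphic**: the handlebodies themselves are diffeomorphic by the discharged
classification UNIQ₄ (`nonempty_diffeomorph_of_hasHandleDecomposition_handleCount_one_holds`;
Kosinski, *Differential Manifolds* (1993), VI (11.4)(c): "genus and orientability form a complete
set of diffeomorphism invariants"), and a diffeomorphism restricts to the boundary data
(`BoundaryData.restrictDiffeomorph`, Lee Thm. 5.11).  Classically both boundaries are
`#ᵏ(S¹ × S²)` (Kirby (1989), Ch. I §2, p. 8). [cite: Kosinski1993, VI (11.4)(c)]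
[cite: Kirby1989, Ch. I §2 (p. 8)] -/
theorem nonempty_diffeomorph_boundary_of_handleCount_one (k : ℕ)
    (V : Type u) [TopologicalSpace V] [T2Space V] [SecondCountableTopology V] [CompactSpace V]
    [ConnectedSpace V] [ChartedSpace (EuclideanHalfSpace 4) V] [IsManifold (𝓡∂ 4) ∞ V]
    (hV : HasHandleDecomposition 3 V (handleCount 1 k)) (ho : IsOrientable (𝓡∂ 4) V)
    (bV : BoundaryData (𝓡∂ 4) V (𝓡 3))
    (V' : Type u) [TopologicalSpace V'] [T2Space V'] [SecondCountableTopology V'] [CompactSpace V']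
    [ConnectedSpace V'] [ChartedSpace (EuclideanHalfSpace 4) V'] [IsManifold (𝓡∂ 4) ∞ V']
    (hV' : HasHandleDecomposition 3 V' (handleCount 1 k)) (ho' : IsOrientable (𝓡∂ 4) V')
    (bV' : BoundaryData (𝓡∂ 4) V' (𝓡 3)) :
    Nonempty (bV.carrier ≃ₘ⟮𝓡 3, 𝓡 3⟯ bV'.carrier) := by
  obtain ⟨φ⟩ :=
    nonempty_diffeomorph_of_hasHandleDecomposition_handleCount_one_holds k V V' hV ho hV' ho'
  exact ⟨bV.restrictDiffeomorph bV' φ⟩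

/-- **The "every `V`" of the fact costs nothing: one model per `k` suffices.**  If a `3`-manifold
`Y` is diffeomorphic to the boundary of SOME compact connected orientable `4`-dimensional
handlebody `V₀` of type `(1, k)`, then it is diffeomorphic to the boundary of EVERY such `V` of the
same universe (`nonempty_diffeomorph_boundary_of_handleCount_one`). [cite: Kosinski1993, VI (11.4)(c)] -/
theorem nonempty_diffeomorph_boundary_of_model {k : ℕ} {Y : Type*} [TopologicalSpace Y]
    [ChartedSpace (EuclideanSpace ℝ (Fin 3)) Y]
    (V₀ : Type u) [TopologicalSpace V₀] [T2Space V₀] [SecondCountableTopology V₀] [CompactSpace V₀]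
    [ConnectedSpace V₀] [ChartedSpace (EuclideanHalfSpace 4) V₀] [IsManifold (𝓡∂ 4) ∞ V₀]
    (hV₀ : HasHandleDecomposition 3 V₀ (handleCount 1 k)) (ho₀ : IsOrientable (𝓡∂ 4) V₀)
    (b₀ : BoundaryData (𝓡∂ 4) V₀ (𝓡 3)) (e : Y ≃ₘ⟮𝓡 3, 𝓡 3⟯ b₀.carrier)
    (V : Type u) [TopologicalSpace V] [T2Space V] [SecondCountableTopology V] [CompactSpace V]
    [ConnectedSpace V] [ChartedSpace (EuclideanHalfSpace 4) V] [IsManifold (𝓡∂ 4) ∞ V]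
    (hV : HasHandleDecomposition 3 V (handleCount 1 k)) (ho : IsOrientable (𝓡∂ 4) V)
    (bV : BoundaryData (𝓡∂ 4) V (𝓡 3)) :
    Nonempty (Y ≃ₘ⟮𝓡 3, 𝓡 3⟯ bV.carrier) := by
  obtain ⟨ψ⟩ := nonempty_diffeomorph_boundary_of_handleCount_one k V₀ hV₀ ho₀ b₀ V hV ho bV
  exact ⟨e.trans ψ⟩

/-- **In genus zero the boundary is `S³`**: a compact connected orientable smooth `4`-manifold
with a handle decomposition with one `0`-handle and no other handle is diffeomorphic to the lifted
ball `ULift 𝔻⁴` (UNIQ₄ with the handle decomposition `‖x‖²` of `𝔻⁴`,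
`hasHandleDecomposition_closedBall`), whose boundary datum `(closedBallBoundaryData 3).ulift` has
carrier `ULift 𝕊³ ≅ 𝕊³`; so every boundary datum of `V` has carrier diffeomorphic to `𝕊³`
(Kirby (1989), Ch. I §2, p. 8, `k = 0`: `∂B⁴ = S³`). [cite: Kirby1989, Ch. I §2 (p. 8)]
[cite: Kosinski1993, VI (11.4)(c)] -/
theorem nonempty_diffeomorph_boundary_sphere_of_handleCount_one_zero
    (V : Type u) [TopologicalSpace V] [T2Space V] [SecondCountableTopology V] [CompactSpace V]
    [ConnectedSpace V] [ChartedSpace (EuclideanHalfSpace 4) V] [IsManifold (𝓡∂ 4) ∞ V]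
    (hV : HasHandleDecomposition 3 V (handleCount 1 0)) (ho : IsOrientable (𝓡∂ 4) V)
    (bV : BoundaryData (𝓡∂ 4) V (𝓡 3)) :
    Nonempty (bV.carrier ≃ₘ⟮𝓡 3, 𝓡 3⟯ (Metric.sphere (0 : EuclideanSpace ℝ (Fin 4)) 1)) := by
  haveI : Fact (isSmoothEmbedding_sphereInclusion' 3) :=
    ⟨isSmoothEmbedding_sphereInclusion'_holds 3⟩
  haveI : ConnectedSpace (Metric.closedBall (0 : EuclideanSpace ℝ (Fin 4)) 1) :=
    connectedSpace_closedBall 3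
  have hkD : HasHandleDecomposition 3
      (ULift.{u} (Metric.closedBall (0 : EuclideanSpace ℝ (Fin 4)) 1)) (handleCount 1 0) :=
    ManifoldULift.hasHandleDecomposition (hasHandleDecomposition_closedBall 3)
  have hoD :
      IsOrientable (𝓡∂ 4) (ULift.{u} (Metric.closedBall (0 : EuclideanSpace ℝ (Fin 4)) 1)) :=
    ManifoldULift.isOrientable (isOrientable_closedBall 3)
  obtain ⟨e⟩ := nonempty_diffeomorph_boundary_of_handleCount_one 0 V hV ho bV
    (ULift.{u} (Metric.closedBall (0 : EuclideanSpace ℝ (Fin 4)) 1)) hkD hoD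
    (closedBallBoundaryData 3).ulift
  exact ⟨e.trans
    (ManifoldULift.diffeomorph (𝓡 3) (Metric.sphere (0 : EuclideanSpace ℝ (Fin 4)) 1) ∞)⟩

/-! ### §3 The genus-zero slice of the fact is Perelman's theorem (spc4.S31, smooth form) -/

/-- **spc4.S31 ⟹ the fact in genus zero** (every universe, and without the orientability
hypothesis on `Y`): a closed connected smooth `3`-manifold `Y` with `π₁(Y, y)` free of rank `0`
is simply connected (§1), hence diffeomorphic to `𝕊³` by
`nonempty_diffeomorph_sphere_three` (Perelman; Morgan–Tian (2007), Cor. 0.2 (a)), and `𝕊³` is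
the boundary of every compact connected orientable `4`-dimensional handlebody of type `(1, 0)`
(`nonempty_diffeomorph_boundary_sphere_of_handleCount_one_zero`).  This is the case `k = 0` of
Abrams–Gay–Kirby's derivation ("Perelman's proof … shows that no connected summand has trivial
fundamental group"). [cite: AbramsGayKirby2018, p. 4 (proof of Thm. 5)]
[cite: MorganTian2007, Cor. 0.2 (a)] -/
theorem diffeomorph_sumS1S2_of_isFreeOfRank_fundamentalGroup_zero_of_sphere_three
    (h3 : nonempty_diffeomorph_sphere_three.{u})
    (Y : Type u) [TopologicalSpace Y] [T2Space Y] [SecondCountableTopology Y]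
    [ChartedSpace (EuclideanSpace ℝ (Fin 3)) Y] [IsManifold (𝓡 3) ∞ Y] [CompactSpace Y]
    [ConnectedSpace Y] (y : Y) (hY : IsFreeOfRank (FundamentalGroup Y y) 0)
    (V : Type u) [TopologicalSpace V] [T2Space V] [SecondCountableTopology V] [CompactSpace V]
    [ConnectedSpace V] [ChartedSpace (EuclideanHalfSpace 4) V] [IsManifold (𝓡∂ 4) ∞ V]
    (hV : HasHandleDecomposition 3 V (handleCount 1 0)) (ho : IsOrientable (𝓡∂ 4) V)
    (bV : BoundaryData (𝓡∂ 4) V (𝓡 3)) :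
    Nonempty (Y ≃ₘ⟮𝓡 3, 𝓡 3⟯ bV.carrier) := by
  haveI : SimplyConnectedSpace Y :=
    simplyConnectedSpace_of_isFreeOfRank_fundamentalGroup_zero (𝓡 3) hY
  obtain ⟨eY⟩ := h3 Y
  obtain ⟨eV⟩ := nonempty_diffeomorph_boundary_sphere_of_handleCount_one_zero V hV ho bV
  exact ⟨eY.trans eV.symm⟩

/-- **The fact in genus zero ⟹ spc4.S31** (every universe).  Let `M` be a closed simply
connected smooth `3`-manifold.  It is connected (simply connected spaces are path connected),
orientable (Lee, *Introduction to Smooth Manifolds* (2013), Thm. 15.43: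
`isOrientable_of_simplyConnectedSpace_holds`) and `π₁(M, x)` is free of rank `0` (§1); the
genus-zero slice of `diffeomorph_sumS1S2_of_isFreeOfRank_fundamentalGroup`, evaluated at the model
`ULift 𝔻⁴` of type `(1, 0)` (`hasHandleDecomposition_closedBall`, `isOrientable_closedBall`,
lifted by `ManifoldULift`) with boundary datum `(closedBallBoundaryData 3).ulift`, makes `M`
diffeomorphic to `ULift 𝕊³ ≅ 𝕊³`. [cite: AbramsGayKirby2018, p. 4 (proof of Thm. 5)]
[cite: LeeSmoothManifolds2013, Thm. 15.43] [cite: MorganTian2007, Cor. 0.2 (a)] -/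
theorem nonempty_diffeomorph_sphere_three_of_genusZero
    (h0 : ∀ (Y : Type u) [TopologicalSpace Y] [T2Space Y] [SecondCountableTopology Y]
      [ChartedSpace (EuclideanSpace ℝ (Fin 3)) Y] [IsManifold (𝓡 3) ∞ Y] [CompactSpace Y]
      [ConnectedSpace Y] (_ : IsOrientable (𝓡 3) Y) (y : Y)
      (_ : IsFreeOfRank (FundamentalGroup Y y) 0)
      (V : Type u) [TopologicalSpace V] [T2Space V] [SecondCountableTopology V] [CompactSpace V]
      [ConnectedSpace V] [ChartedSpace (EuclideanHalfSpace 4) V] [IsManifold (𝓡∂ 4) ∞ V]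
      (_ : HasHandleDecomposition 3 V (handleCount 1 0)) (_ : IsOrientable (𝓡∂ 4) V)
      (bV : BoundaryData (𝓡∂ 4) V (𝓡 3)),
      Nonempty (Y ≃ₘ⟮𝓡 3, 𝓡 3⟯ bV.carrier)) :
    nonempty_diffeomorph_sphere_three.{u} := by
  intro M _ _ _ _ _ _ _
  haveI : Fact (isSmoothEmbedding_sphereInclusion' 3) :=
    ⟨isSmoothEmbedding_sphereInclusion'_holds 3⟩
  haveI : ConnectedSpace (Metric.closedBall (0 : EuclideanSpace ℝ (Fin 4)) 1) :=
    connectedSpace_closedBall 3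
  -- `M` is orientable and `π₁(M, x) = 1 = F₀`
  have hMo : IsOrientable (𝓡 3) M := isOrientable_of_simplyConnectedSpace_holds
  obtain ⟨x⟩ : Nonempty M := inferInstance
  have hπ : IsFreeOfRank (FundamentalGroup M x) 0 := isFreeOfRank_fundamentalGroup_zero x
  -- the model `ULift 𝔻⁴` of type `(1, 0)` in universe `u`, with boundary datum `ULift 𝕊³`
  have hkD : HasHandleDecomposition 3
      (ULift.{u} (Metric.closedBall (0 : EuclideanSpace ℝ (Fin 4)) 1)) (handleCount 1 0) :=
    ManifoldULift.hasHandleDecomposition (hasHandleDecomposition_closedBall 3)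
  have hoD :
      IsOrientable (𝓡∂ 4) (ULift.{u} (Metric.closedBall (0 : EuclideanSpace ℝ (Fin 4)) 1)) :=
    ManifoldULift.isOrientable (isOrientable_closedBall 3)
  obtain ⟨e⟩ := h0 M hMo x hπ (ULift.{u} (Metric.closedBall (0 : EuclideanSpace ℝ (Fin 4)) 1))
    hkD hoD (closedBallBoundaryData 3).ulift
  exact ⟨e.trans
    (ManifoldULift.diffeomorph (𝓡 3) (Metric.sphere (0 : EuclideanSpace ℝ (Fin 4)) 1) ∞)⟩

/-- **The genus-zero slice of `diffeomorph_sumS1S2_of_isFreeOfRank_fundamentalGroup` is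
equivalent to spc4.S31 `nonempty_diffeomorph_sphere_three`** (the 3-dimensional Poincaré
conjecture, Perelman; Morgan–Tian (2007), Cor. 0.2 (a)), in every universe: the slice is the body
of the fact at `k = 0` written out (`nonempty_diffeomorph_sphere_three_of_genusZero`,
`diffeomorph_sumS1S2_of_isFreeOfRank_fundamentalGroup_zero_of_sphere_three`).  In particular
the fact cannot be discharged before spc4.S31 is. [cite: AbramsGayKirby2018, p. 4 (proof of Thm. 5)]
[cite: MorganTian2007, Cor. 0.2 (a)] -/
theorem diffeomorph_sumS1S2_of_isFreeOfRank_fundamentalGroup_zero_iff_sphere_three :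
    (∀ (Y : Type u) [TopologicalSpace Y] [T2Space Y] [SecondCountableTopology Y]
      [ChartedSpace (EuclideanSpace ℝ (Fin 3)) Y] [IsManifold (𝓡 3) ∞ Y] [CompactSpace Y]
      [ConnectedSpace Y] (_ : IsOrientable (𝓡 3) Y) (y : Y)
      (_ : IsFreeOfRank (FundamentalGroup Y y) 0)
      (V : Type u) [TopologicalSpace V] [T2Space V] [SecondCountableTopology V] [CompactSpace V]
      [ConnectedSpace V] [ChartedSpace (EuclideanHalfSpace 4) V] [IsManifold (𝓡∂ 4) ∞ V]
      (_ : HasHandleDecomposition 3 V (handleCount 1 0)) (_ : IsOrientable (𝓡∂ 4) V)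
      (bV : BoundaryData (𝓡∂ 4) V (𝓡 3)),
      Nonempty (Y ≃ₘ⟮𝓡 3, 𝓡 3⟯ bV.carrier)) ↔ nonempty_diffeomorph_sphere_three.{u} :=
  ⟨nonempty_diffeomorph_sphere_three_of_genusZero,
    fun h3 Y _ _ _ _ _ _ _ _ y hY V _ _ _ _ _ _ _ hV ho bV =>
      diffeomorph_sumS1S2_of_isFreeOfRank_fundamentalGroup_zero_of_sphere_three h3 Y y hY V hV
        ho bV⟩

/-- **The fact implies Perelman's theorem**: `diffeomorph_sumS1S2_of_isFreeOfRank_fundamentalGroup`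
(universe `u`) contains its genus-zero slice, which is spc4.S31
`nonempty_diffeomorph_sphere_three` at universe `u` (`nonempty_diffeomorph_sphere_three_of_genusZero`).
This is the honest size of the named fact: it is at least the 3-dimensional Poincaré conjecture
(Abrams–Gay–Kirby cite "Perelman's proof [MorganTian]" for exactly this step).
[cite: AbramsGayKirby2018, p. 4 (proof of Thm. 5)] [cite: MorganTian2007, Cor. 0.2 (a)] -/
theorem nonempty_diffeomorph_sphere_three_of_diffeomorph_sumS1S2
    (h : diffeomorph_sumS1S2_of_isFreeOfRank_fundamentalGroup.{u}) :
    nonempty_diffeomorph_sphere_three.{u} :=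
  nonempty_diffeomorph_sphere_three_of_genusZero (h 0)

/-! ### §4 The boundaries are instances: the hypothesis class of the fact is inhabited (appended) -/

/-- **`π₁(∂V) ≅ F_k` for a compact connected `4`-dimensional handlebody `V` of type `(1, k)`**,
at every point of every boundary datum: `π₁(V, v) ≅ F_k` (Matsumoto, *An introduction to Morse
theory* (2001), §5.3; Milnor 1963, Thm. 3.5: `HasHandleDecomposition.isFreeOfRank_fundamentalGroup`)
and `(bV.incl)_# : π₁(bV.carrier, z) ≅ π₁(V, bV.incl z)` (the dual handles have dimension `≥ 3`;
Laudenbach–Poénaru (1972), p. 339: `HasHandleDecomposition.inclFundamentalGroupEquiv`).  This is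
the easy half of "`∂(♮ᵏ S¹ × B³) = #ᵏ S¹ × S²` has `π₁` free of rank `k`" (Hempel (1976), Ch. 3;
Kirby (1989), Ch. I §2, p. 8). [cite: Matsumoto2001, §5.3 (PDF p. 158)]
[cite: LaudenbachPoenaruBSMF1972, §2, p. 339] -/
theorem isFreeOfRank_fundamentalGroup_boundary_of_handleCount_one {k : ℕ}
    {V : Type u} [TopologicalSpace V] [T2Space V] [SecondCountableTopology V] [CompactSpace V]
    [ConnectedSpace V] [ChartedSpace (EuclideanHalfSpace 4) V] [IsManifold (𝓡∂ 4) ∞ V]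
    (hV : HasHandleDecomposition 3 V (handleCount 1 k)) (bV : BoundaryData (𝓡∂ 4) V (𝓡 3))
    (z : bV.carrier) : IsFreeOfRank (FundamentalGroup bV.carrier z) k :=
  (hV.isFreeOfRank_fundamentalGroup (handleCount_zero 1 k) (handleCount_one 1 k)
      (fun _ hj => handleCount_of_two_le 1 k hj) (bV.incl z)).of_mulEquiv
    (hV.inclFundamentalGroupEquiv bV z).symm

/-- **`∂V` is connected** for a compact connected `4`-dimensional handlebody `V` of type `(1, k)`
and any boundary datum (handles of coindex `≥ 2` do not disconnect the boundary, Kosinski (1993),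
VI (11.5): `HasHandleDecomposition.pathConnectedSpace_carrier`). [cite: Kosinski1993, VI (11.5)] -/
theorem connectedSpace_boundary_of_handleCount_one {k : ℕ}
    {V : Type u} [TopologicalSpace V] [T2Space V] [CompactSpace V] [ConnectedSpace V]
    [ChartedSpace (EuclideanHalfSpace 4) V] [IsManifold (𝓡∂ 4) ∞ V]
    (hV : HasHandleDecomposition 3 V (handleCount 1 k)) (bV : BoundaryData (𝓡∂ 4) V (𝓡 3)) :
    ConnectedSpace bV.carrier := by
  haveI : PathConnectedSpace bV.carrier := hV.pathConnectedSpace_carrier bV (by norm_num)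
  infer_instance

/-- **The hypothesis class of the fact is inhabited in every genus `k` and every universe** (so
the named fact is not vacuous for any `k`): the boundary `Y = ∂V` of a compact connected
orientable `4`-dimensional handlebody `V` of type `(1, k)` — such `V` exist
(`exists_oneHandlebody_four`: the solid bodies `{q(x, y) + z² + w² ≤ c} ⊂ ℝ⁴`, lifted to
universe `u` by `ManifoldULift`), with its canonical boundary datum
(`BoundaryManifold.boundaryData`, Lee Thm. 5.11) — is a closed (compact, Hausdorff, second
countable), connected, orientable (`BoundaryData.isOrientable_carrier`, Hirsch §4.4) smooth
`3`-manifold with `π₁` free of rank `k`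
(`isFreeOfRank_fundamentalGroup_boundary_of_handleCount_one`).  Classically `Y = #ᵏ(S¹ × S²)`
(Kirby (1989), Ch. I §2, p. 8). [cite: Kirby1989, Ch. I §2 (p. 8)] [cite: Kosinski1993, VI (11.5)] -/
theorem exists_isFreeOfRank_fundamentalGroup_closedThreeManifold (k : ℕ) :
    ∃ (Y : Type u) (_ : TopologicalSpace Y) (_ : T2Space Y) (_ : SecondCountableTopology Y)
      (_ : ChartedSpace (EuclideanSpace ℝ (Fin 3)) Y) (_ : IsManifold (𝓡 3) ∞ Y)
      (_ : CompactSpace Y) (_ : ConnectedSpace Y) (y : Y),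
      IsOrientable (𝓡 3) Y ∧ IsFreeOfRank (FundamentalGroup Y y) k := by
  obtain ⟨V, _, _, _, _, _, _, _, ho, hV, -⟩ := exists_oneHandlebody_four k
  -- the model lifted to universe `u`, with its canonical boundary datum
  have hVu : HasHandleDecomposition 3 (ULift.{u} V) (handleCount 1 k) :=
    ManifoldULift.hasHandleDecomposition hV
  have hou : IsOrientable (𝓡∂ 4) (ULift.{u} V) := ManifoldULift.isOrientable ho
  set b : BoundaryData (𝓡∂ 4) (ULift.{u} V) (𝓡 3) := BoundaryManifold.boundaryData 3 (ULift.{u} V)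
  haveI : T2Space b.carrier := b.t2Space_carrier
  haveI : SecondCountableTopology b.carrier := b.secondCountableTopology_carrier
  haveI : CompactSpace b.carrier := b.compactSpace_carrier
  haveI : ConnectedSpace b.carrier := connectedSpace_boundary_of_handleCount_one hVu b
  obtain ⟨z⟩ : Nonempty b.carrier := inferInstance
  exact ⟨b.carrier, inferInstance, inferInstance, inferInstance, inferInstance, inferInstance,
    inferInstance, inferInstance, z, b.isOrientable_carrier hou,
    isFreeOfRank_fundamentalGroup_boundary_of_handleCount_one hVu b z⟩

/-- **… and on these instances the fact holds** (by §2, with no `3`-manifold topology): the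
boundary of any compact connected orientable `V'` of type `(1, k)` — closed, connected, orientable,
`π₁` free of rank `k` by the above — is diffeomorphic to the boundary of every other such `V`.  What
the named fact adds is that EVERY closed connected orientable `Y` with `π₁(Y) ≅ F_k` arises this way
(Hempel 5.3). [cite: Kosinski1993, VI (11.4)(c)] [cite: AbramsGayKirby2018, p. 4 (proof of Thm. 5)] -/
theorem diffeomorph_sumS1S2_of_isFreeOfRank_fundamentalGroup_of_boundary (k : ℕ)
    (V' : Type u) [TopologicalSpace V'] [T2Space V'] [SecondCountableTopology V'] [CompactSpace V']
    [ConnectedSpace V'] [ChartedSpace (EuclideanHalfSpace 4) V'] [IsManifold (𝓡∂ 4) ∞ V']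
    (hV' : HasHandleDecomposition 3 V' (handleCount 1 k)) (ho' : IsOrientable (𝓡∂ 4) V')
    (bV' : BoundaryData (𝓡∂ 4) V' (𝓡 3))
    (V : Type u) [TopologicalSpace V] [T2Space V] [SecondCountableTopology V] [CompactSpace V]
    [ConnectedSpace V] [ChartedSpace (EuclideanHalfSpace 4) V] [IsManifold (𝓡∂ 4) ∞ V]
    (hV : HasHandleDecomposition 3 V (handleCount 1 k)) (ho : IsOrientable (𝓡∂ 4) V)
    (bV : BoundaryData (𝓡∂ 4) V (𝓡 3)) :
    IsOrientable (𝓡 3) bV'.carrier ∧ (∀ z, IsFreeOfRank (FundamentalGroup bV'.carrier z) k) ∧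
      Nonempty (bV'.carrier ≃ₘ⟮𝓡 3, 𝓡 3⟯ bV.carrier) :=
  ⟨bV'.isOrientable_carrier ho', isFreeOfRank_fundamentalGroup_boundary_of_handleCount_one hV' bV',
    nonempty_diffeomorph_boundary_of_handleCount_one k V' hV' ho' bV' V hV ho bV⟩

/-! ### §5 The fact is a classification statement about closed `3`-manifolds (appended) -/

/-- **The fact ⟹ closed connected orientable smooth `3`-manifolds with `π₁` free of the same rank
are diffeomorphic** (Hempel (1976), 5.3 with Perelman: both are `#ᵏ(S¹ × S²)`).  Compact connected
orientable `4`-dimensional `1`-handlebodies `V` of type `(1, k)` exist in every universe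
(`exists_oneHandlebody_four`, lifted by `ManifoldULift`), and the fact makes both manifolds
diffeomorphic to the boundary of one of them. [cite: Hempel1976, Thm. 5.2, 5.3]
[cite: AbramsGayKirby2018, p. 4 (proof of Thm. 5)] -/
theorem nonempty_diffeomorph_of_isFreeOfRank_of_diffeomorph_sumS1S2
    (h : diffeomorph_sumS1S2_of_isFreeOfRank_fundamentalGroup.{u}) (k : ℕ)
    (Y : Type u) [TopologicalSpace Y] [T2Space Y] [SecondCountableTopology Y]
    [ChartedSpace (EuclideanSpace ℝ (Fin 3)) Y] [IsManifold (𝓡 3) ∞ Y] [CompactSpace Y]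
    [ConnectedSpace Y] (hYo : IsOrientable (𝓡 3) Y) (y : Y)
    (hY : IsFreeOfRank (FundamentalGroup Y y) k)
    (Y' : Type u) [TopologicalSpace Y'] [T2Space Y'] [SecondCountableTopology Y']
    [ChartedSpace (EuclideanSpace ℝ (Fin 3)) Y'] [IsManifold (𝓡 3) ∞ Y'] [CompactSpace Y']
    [ConnectedSpace Y'] (hYo' : IsOrientable (𝓡 3) Y') (y' : Y')
    (hY' : IsFreeOfRank (FundamentalGroup Y' y') k) :
    Nonempty (Y ≃ₘ⟮𝓡 3, 𝓡 3⟯ Y') := by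
  obtain ⟨V, _, _, _, _, _, _, _, ho, hV, -⟩ := exists_oneHandlebody_four k
  have hVu : HasHandleDecomposition 3 (ULift.{u} V) (handleCount 1 k) :=
    ManifoldULift.hasHandleDecomposition hV
  have hou : IsOrientable (𝓡∂ 4) (ULift.{u} V) := ManifoldULift.isOrientable ho
  obtain ⟨e⟩ := h k Y hYo y hY (ULift.{u} V) hVu hou (BoundaryManifold.boundaryData 3 (ULift.{u} V))
  obtain ⟨e'⟩ :=
    h k Y' hYo' y' hY' (ULift.{u} V) hVu hou (BoundaryManifold.boundaryData 3 (ULift.{u} V))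
  exact ⟨e.trans e'.symm⟩

/-- **Closed connected orientable smooth `3`-manifolds with `π₁` free of the same rank are
diffeomorphic ⟹ the fact**: the boundary `bV.carrier` of a compact connected orientable
`4`-dimensional handlebody `V` of type `(1, k)` is itself a closed connected orientable `3`-manifold
with `π₁` free of rank `k` (§4: `connectedSpace_boundary_of_handleCount_one`,
`BoundaryData.isOrientable_carrier`, `isFreeOfRank_fundamentalGroup_boundary_of_handleCount_one`),
so the classification applies to the pair `Y`, `bV.carrier`.  With the previous theorem: the
`4`-dimensional language of the fact ("`∂V` for every `V ≅ ♮ᵏ S¹ × B³`") is inessential — what it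
asserts is Hempel's classification 5.3 of closed orientable `3`-manifolds with free `π₁` (with
Perelman for the homotopy-sphere summand). [cite: Hempel1976, Thm. 5.2, 5.3]
[cite: AbramsGayKirby2018, p. 4 (proof of Thm. 5)] -/
theorem diffeomorph_sumS1S2_of_isFreeOfRank_fundamentalGroup_of_classification
    (h : ∀ (k : ℕ) (Y : Type u) [TopologicalSpace Y] [T2Space Y] [SecondCountableTopology Y]
      [ChartedSpace (EuclideanSpace ℝ (Fin 3)) Y] [IsManifold (𝓡 3) ∞ Y] [CompactSpace Y]
      [ConnectedSpace Y] (_ : IsOrientable (𝓡 3) Y) (y : Y)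
      (_ : IsFreeOfRank (FundamentalGroup Y y) k)
      (Y' : Type u) [TopologicalSpace Y'] [T2Space Y'] [SecondCountableTopology Y']
      [ChartedSpace (EuclideanSpace ℝ (Fin 3)) Y'] [IsManifold (𝓡 3) ∞ Y'] [CompactSpace Y']
      [ConnectedSpace Y'] (_ : IsOrientable (𝓡 3) Y') (y' : Y')
      (_ : IsFreeOfRank (FundamentalGroup Y' y') k), Nonempty (Y ≃ₘ⟮𝓡 3, 𝓡 3⟯ Y')) :
    diffeomorph_sumS1S2_of_isFreeOfRank_fundamentalGroup.{u} := by
  intro k Y _ _ _ _ _ _ _ hYo y hY V _ _ _ _ _ _ _ hV ho bV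
  haveI : T2Space bV.carrier := bV.t2Space_carrier
  haveI : SecondCountableTopology bV.carrier := bV.secondCountableTopology_carrier
  haveI : CompactSpace bV.carrier := bV.compactSpace_carrier
  haveI : ConnectedSpace bV.carrier := connectedSpace_boundary_of_handleCount_one hV bV
  obtain ⟨z⟩ : Nonempty bV.carrier := inferInstance
  exact h k Y hYo y hY bV.carrier (bV.isOrientable_carrier ho) z
    (isFreeOfRank_fundamentalGroup_boundary_of_handleCount_one hV bV z)

/-- **`diffeomorph_sumS1S2_of_isFreeOfRank_fundamentalGroup` ⟺ closed connected orientable smooth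
`3`-manifolds with free `π₁` of the same rank are diffeomorphic** (every universe; the two
previous theorems).  The right-hand side is Hempel (1976), 5.3 for closed orientable manifolds
(`M = Σ # B₁ # ⋯ # B_r`, `r = rank π₁(M)`, `B_j = S¹ × S²`) together with Perelman's theorem
`Σ ≅ S³` (Morgan–Tian (2007), Cor. 0.2 (a)); no `4`-manifold enters. [cite: Hempel1976, Thm. 5.2, 5.3]
[cite: MorganTian2007, Cor. 0.2 (a)] [cite: AbramsGayKirby2018, p. 4 (proof of Thm. 5)] -/
theorem diffeomorph_sumS1S2_of_isFreeOfRank_fundamentalGroup_iff_classification :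
    diffeomorph_sumS1S2_of_isFreeOfRank_fundamentalGroup.{u} ↔
      ∀ (k : ℕ) (Y : Type u) [TopologicalSpace Y] [T2Space Y] [SecondCountableTopology Y]
        [ChartedSpace (EuclideanSpace ℝ (Fin 3)) Y] [IsManifold (𝓡 3) ∞ Y] [CompactSpace Y]
        [ConnectedSpace Y] (_ : IsOrientable (𝓡 3) Y) (y : Y)
        (_ : IsFreeOfRank (FundamentalGroup Y y) k)
        (Y' : Type u) [TopologicalSpace Y'] [T2Space Y'] [SecondCountableTopology Y']
        [ChartedSpace (EuclideanSpace ℝ (Fin 3)) Y'] [IsManifold (𝓡 3) ∞ Y'] [CompactSpace Y']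
        [ConnectedSpace Y'] (_ : IsOrientable (𝓡 3) Y') (y' : Y')
        (_ : IsFreeOfRank (FundamentalGroup Y' y') k), Nonempty (Y ≃ₘ⟮𝓡 3, 𝓡 3⟯ Y') :=
  ⟨fun h k Y _ _ _ _ _ _ _ hYo y hY Y' _ _ _ _ _ _ _ hYo' y' hY' =>
      nonempty_diffeomorph_of_isFreeOfRank_of_diffeomorph_sumS1S2 h k Y hYo y hY Y' hYo' y' hY',
    diffeomorph_sumS1S2_of_isFreeOfRank_fundamentalGroup_of_classification⟩

/-! ### §6 Universe lowering: the fact over `Type` implies it in every universe (appended) -/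

/-- **The classification at universe `0` implies it at every universe.**  A closed `3`-manifold
`Y : Type u` is second countable, hence small (`small_of_secondCountableTopology`); its `C^∞`
structure is transported to `Shrink.{0} Y : Type` along `φ = Shrink.homeomorph Y`
(`Homeomorph.transportChartedSpace`, `Homeomorph.isManifold_transportChartedSpace`), making `φ` a
diffeomorphism (`Homeomorph.transportDiffeomorph`); the copy is again closed, connected
(`Homeomorph.connectedSpace_iff`), orientable (pull back an orientation along `φ⁻¹`,
`SmoothOrientation.comap`; Hirsch §4.4, p. 101) and has
`π₁` free of the same rank (`φ_# : π₁(Y, y) ≅ π₁(Shrink Y, φ y)`, `Homeomorph.fundamentalGroupCongr`).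
Do this for both manifolds and conjugate the diffeomorphism given over `Type`.  (Same device as
`nonempty_diffeomorph_sphere_three_of_univ_zero`, `SPC4Wave0Proofs.lean`.) [folklore] -/
theorem nonempty_diffeomorph_of_isFreeOfRank_of_univ_zero
    (h : ∀ (k : ℕ) (Y : Type) [TopologicalSpace Y] [T2Space Y] [SecondCountableTopology Y]
      [ChartedSpace (EuclideanSpace ℝ (Fin 3)) Y] [IsManifold (𝓡 3) ∞ Y] [CompactSpace Y]
      [ConnectedSpace Y] (_ : IsOrientable (𝓡 3) Y) (y : Y)
      (_ : IsFreeOfRank (FundamentalGroup Y y) k)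
      (Y' : Type) [TopologicalSpace Y'] [T2Space Y'] [SecondCountableTopology Y']
      [ChartedSpace (EuclideanSpace ℝ (Fin 3)) Y'] [IsManifold (𝓡 3) ∞ Y'] [CompactSpace Y']
      [ConnectedSpace Y'] (_ : IsOrientable (𝓡 3) Y') (y' : Y')
      (_ : IsFreeOfRank (FundamentalGroup Y' y') k), Nonempty (Y ≃ₘ⟮𝓡 3, 𝓡 3⟯ Y')) (k : ℕ)
    (Y : Type u) [TopologicalSpace Y] [T2Space Y] [SecondCountableTopology Y]
    [ChartedSpace (EuclideanSpace ℝ (Fin 3)) Y] [IsManifold (𝓡 3) ∞ Y] [CompactSpace Y]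
    [ConnectedSpace Y] (hYo : IsOrientable (𝓡 3) Y) (y : Y)
    (hY : IsFreeOfRank (FundamentalGroup Y y) k)
    (Y' : Type u) [TopologicalSpace Y'] [T2Space Y'] [SecondCountableTopology Y']
    [ChartedSpace (EuclideanSpace ℝ (Fin 3)) Y'] [IsManifold (𝓡 3) ∞ Y'] [CompactSpace Y']
    [ConnectedSpace Y'] (hYo' : IsOrientable (𝓡 3) Y') (y' : Y')
    (hY' : IsFreeOfRank (FundamentalGroup Y' y') k) :
    Nonempty (Y ≃ₘ⟮𝓡 3, 𝓡 3⟯ Y') := by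
  -- the copy of `Y` in `Type`
  haveI : Small.{0} Y := small_of_secondCountableTopology Y
  let φ : Y ≃ₜ Shrink.{0} Y := Shrink.homeomorph Y
  letI : ChartedSpace (EuclideanSpace ℝ (Fin 3)) (Shrink.{0} Y) :=
    Homeomorph.transportChartedSpace φ
  haveI : IsManifold (𝓡 3) ∞ (Shrink.{0} Y) :=
    Homeomorph.isManifold_transportChartedSpace (I₀ := 𝓡 3) (n := ∞) φ
  haveI : T2Space (Shrink.{0} Y) := φ.t2Space
  haveI : SecondCountableTopology (Shrink.{0} Y) := φ.symm.secondCountableTopology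
  haveI : CompactSpace (Shrink.{0} Y) := φ.compactSpace
  haveI : ConnectedSpace (Shrink.{0} Y) := φ.connectedSpace_iff.1 inferInstance
  let Φ := Homeomorph.transportDiffeomorph (I₀ := 𝓡 3) (n := ∞) φ
  have hso : IsOrientable (𝓡 3) (Shrink.{0} Y) := by
    obtain ⟨o⟩ := hYo
    exact ⟨o.comap Φ.symm (by simp)⟩
  have hsπ : IsFreeOfRank (FundamentalGroup (Shrink.{0} Y) (φ y)) k :=
    hY.of_mulEquiv (Homeomorph.fundamentalGroupCongr φ rfl)
  -- the copy of `Y'` in `Type`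
  haveI : Small.{0} Y' := small_of_secondCountableTopology Y'
  let φ' : Y' ≃ₜ Shrink.{0} Y' := Shrink.homeomorph Y'
  letI : ChartedSpace (EuclideanSpace ℝ (Fin 3)) (Shrink.{0} Y') :=
    Homeomorph.transportChartedSpace φ'
  haveI : IsManifold (𝓡 3) ∞ (Shrink.{0} Y') :=
    Homeomorph.isManifold_transportChartedSpace (I₀ := 𝓡 3) (n := ∞) φ'
  haveI : T2Space (Shrink.{0} Y') := φ'.t2Space
  haveI : SecondCountableTopology (Shrink.{0} Y') := φ'.symm.secondCountableTopology
  haveI : CompactSpace (Shrink.{0} Y') := φ'.compactSpace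
  haveI : ConnectedSpace (Shrink.{0} Y') := φ'.connectedSpace_iff.1 inferInstance
  let Φ' := Homeomorph.transportDiffeomorph (I₀ := 𝓡 3) (n := ∞) φ'
  have hso' : IsOrientable (𝓡 3) (Shrink.{0} Y') := by
    obtain ⟨o'⟩ := hYo'
    exact ⟨o'.comap Φ'.symm (by simp)⟩
  have hsπ' : IsFreeOfRank (FundamentalGroup (Shrink.{0} Y') (φ' y')) k :=
    hY'.of_mulEquiv (Homeomorph.fundamentalGroupCongr φ' rfl)
  obtain ⟨e⟩ := h k (Shrink.{0} Y) hso (φ y) hsπ (Shrink.{0} Y') hso' (φ' y') hsπ'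
  exact ⟨Φ.trans (e.trans Φ'.symm)⟩

/-- **`diffeomorph_sumS1S2_of_isFreeOfRank_fundamentalGroup` over `Type` implies it in every
universe** (§5 down to universe `0`, §6, §5 back up).  Hence a discharge carried out over
`Y : Type` — where the tree's connected-sum calculus (`IsConnectedSum`, `IsConnectedSumOf`,
`IsSphereTwoProdCircleSum`) is formulated — discharges the fact as stated. [folklore] -/
theorem diffeomorph_sumS1S2_of_isFreeOfRank_fundamentalGroup_of_univ_zero
    (h : diffeomorph_sumS1S2_of_isFreeOfRank_fundamentalGroup.{0}) :
    diffeomorph_sumS1S2_of_isFreeOfRank_fundamentalGroup.{u} :=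
  diffeomorph_sumS1S2_of_isFreeOfRank_fundamentalGroup_of_classification
    fun k Y _ _ _ _ _ _ _ hYo y hY Y' _ _ _ _ _ _ _ hYo' y' hY' =>
      nonempty_diffeomorph_of_isFreeOfRank_of_univ_zero
        (fun k Y _ _ _ _ _ _ _ hYo y hY Y' _ _ _ _ _ _ _ hYo' y' hY' =>
          nonempty_diffeomorph_of_isFreeOfRank_of_diffeomorph_sumS1S2 h k Y hYo y hY Y' hYo' y'
            hY')
        k Y hYo y hY Y' hYo' y' hY'

/-! ### §7 What remains, in the tree's `Type`-level vocabulary: Hempel 5.3 and the uniqueness of `#ᵏ(S² × S¹)` (appended) -/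

/-- **The fact from its two `3`-manifold leaves, stated over `Type` in the vocabulary of
`IsSphereTwoProdCircleSum` (`KirbyCalculus.lean`: `Y ≅ #ᵏ(S² × S¹)` as an iterated honest connected
sum `IsConnectedSum`)** — both taken as explicit hypotheses, neither vendored here:
(H53) *Hempel (1976), 5.3 with Perelman*: a closed connected orientable smooth `3`-manifold
`M : Type` with `π₁(M, x)` free of rank `k` satisfies `IsSphereTwoProdCircleSum k M` (Kneser's
conjecture, Thm. 7.1; prime orientable closed manifolds with `π₁ ≅ ℤ` are `S¹ × S²`, Thm. 5.2; the
homotopy-sphere summand is `S³`, Morgan–Tian (2007), Cor. 0.2 (a) — for `k = 0` (H53) is exactly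
spc4.S31 over `Type`, `isSphereTwoProdCircleSum_zero_iff`);
(HU) *the connected sum `#ᵏ(S² × S¹)` is well defined up to diffeomorphism*: two `3`-manifolds
satisfying `IsSphereTwoProdCircleSum k` are diffeomorphic (Kervaire–Milnor (1963), Lemma 2.1, by
the disc theorem of Palais and Cerf; `S² × S¹` admits an orientation-reversing diffeomorphism, so
no orientations are needed; Hempel (1976), Ch. 3, Lemma 3.1 ff.).  THEN the fact holds in every
universe: (H53) and (HU) give the classification over `Type` (§5), which lifts (§6).
[cite: Hempel1976, Thm. 5.2, 5.3 and Thm. 7.1] [cite: KervaireMilnor1963, Lemma 2.1]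
[cite: MorganTian2007, Cor. 0.2 (a)] [cite: AbramsGayKirby2018, p. 4 (proof of Thm. 5)] -/
theorem diffeomorph_sumS1S2_of_isFreeOfRank_fundamentalGroup_of_leaves
    (H53 : ∀ (k : ℕ) (M : Type) [TopologicalSpace M] [T2Space M] [SecondCountableTopology M]
      [ChartedSpace (EuclideanSpace ℝ (Fin 3)) M] [IsManifold (𝓡 3) ∞ M] [CompactSpace M]
      [ConnectedSpace M] (_ : IsOrientable (𝓡 3) M) (x : M)
      (_ : IsFreeOfRank (FundamentalGroup M x) k), IsSphereTwoProdCircleSum k M)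
    (HU : ∀ (k : ℕ) (M : Type) [TopologicalSpace M] [T2Space M] [SecondCountableTopology M]
      [ChartedSpace (EuclideanSpace ℝ (Fin 3)) M] [IsManifold (𝓡 3) ∞ M] [CompactSpace M]
      [ConnectedSpace M] (M' : Type) [TopologicalSpace M'] [T2Space M']
      [SecondCountableTopology M'] [ChartedSpace (EuclideanSpace ℝ (Fin 3)) M']
      [IsManifold (𝓡 3) ∞ M'] [CompactSpace M'] [ConnectedSpace M']
      (_ : IsSphereTwoProdCircleSum k M) (_ : IsSphereTwoProdCircleSum k M'),
      Nonempty (M ≃ₘ⟮𝓡 3, 𝓡 3⟯ M')) :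
    diffeomorph_sumS1S2_of_isFreeOfRank_fundamentalGroup.{u} :=
  diffeomorph_sumS1S2_of_isFreeOfRank_fundamentalGroup_of_univ_zero
    (diffeomorph_sumS1S2_of_isFreeOfRank_fundamentalGroup_of_classification
      fun k Y _ _ _ _ _ _ _ hYo y hY Y' _ _ _ _ _ _ _ hYo' y' hY' =>
        HU k Y Y' (H53 k Y hYo y hY) (H53 k Y' hYo' y' hY'))

/-! ### §8 (HU) is a theorem: the fact, and Perelman's theorem, from Hempel 5.3 alone (appended) -/

/-- **The fact from Hempel's Thm. 5.3 (with Perelman) alone.**  The hypothesis (HU) of §7 —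
`#ᵏ(S² × S¹)` is well defined up to diffeomorphism — is PROVED in the tree
(`IsSphereTwoProdCircleSum.nonempty_diffeomorph`, `SphereTwoProdCircleSumUniqueness.lean`: the
unoriented disc theorem, uniqueness of open gluings, and the orientation-reversing symmetry of
`S² × S¹`; Kervaire–Milnor (1963), Lemma 2.1).  Hence the single remaining hypothesis behind
`diffeomorph_sumS1S2_of_isFreeOfRank_fundamentalGroup` (every universe) is (H53): **a closed
connected orientable smooth `3`-manifold `M : Type` with `π₁(M, x)` free of rank `k` is
`#ᵏ(S² × S¹)` in the sense of `IsSphereTwoProdCircleSum k M`** — Hempel (1976), 5.3 (Kneser's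
conjecture 7.1, prime decomposition 3.15, Thm. 5.2) with Perelman's theorem for the homotopy-sphere
summand (Morgan–Tian (2007), Cor. 0.2 (a)); equivalently the free-`π₁` case of Morgan–Tian's
Thm. 0.1.  Its instance `k = 0` is spc4.S31 over `Type` (next two theorems).
[cite: Hempel1976, Thm. 5.2, 5.3 and Thm. 7.1] [cite: MorganTian2007, Cor. 0.2 (a)]
[cite: KervaireMilnorAnnals1963, §2, Lemma 2.1 (p. 505)] [cite: AbramsGayKirby2018, p. 4 (proof of Thm. 5)] -/
theorem diffeomorph_sumS1S2_of_isFreeOfRank_fundamentalGroup_of_hempel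
    (H53 : ∀ (k : ℕ) (M : Type) [TopologicalSpace M] [T2Space M] [SecondCountableTopology M]
      [ChartedSpace (EuclideanSpace ℝ (Fin 3)) M] [IsManifold (𝓡 3) ∞ M] [CompactSpace M]
      [ConnectedSpace M] (_ : IsOrientable (𝓡 3) M) (x : M)
      (_ : IsFreeOfRank (FundamentalGroup M x) k), IsSphereTwoProdCircleSum k M) :
    diffeomorph_sumS1S2_of_isFreeOfRank_fundamentalGroup.{u} :=
  diffeomorph_sumS1S2_of_isFreeOfRank_fundamentalGroup_of_leaves H53
    fun k M _ _ _ _ _ _ _ M' _ _ _ _ _ _ _ h h' =>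
      IsSphereTwoProdCircleSum.nonempty_diffeomorph k M M' h h'

/-- **(H53) implies Perelman's theorem** (spc4.S31, every universe): through the fact
(`diffeomorph_sumS1S2_of_isFreeOfRank_fundamentalGroup_of_hempel`) and its genus-zero slice
(§3, `nonempty_diffeomorph_sphere_three_of_diffeomorph_sumS1S2`). [cite: MorganTian2007, Cor. 0.2 (a)]
[cite: Hempel1976, Thm. 5.2, 5.3] -/
theorem nonempty_diffeomorph_sphere_three_of_hempel
    (H53 : ∀ (k : ℕ) (M : Type) [TopologicalSpace M] [T2Space M] [SecondCountableTopology M]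
      [ChartedSpace (EuclideanSpace ℝ (Fin 3)) M] [IsManifold (𝓡 3) ∞ M] [CompactSpace M]
      [ConnectedSpace M] (_ : IsOrientable (𝓡 3) M) (x : M)
      (_ : IsFreeOfRank (FundamentalGroup M x) k), IsSphereTwoProdCircleSum k M) :
    nonempty_diffeomorph_sphere_three.{u} :=
  nonempty_diffeomorph_sphere_three_of_diffeomorph_sumS1S2
    (diffeomorph_sumS1S2_of_isFreeOfRank_fundamentalGroup_of_hempel H53)

/-- **Conversely, the instance `k = 0` of (H53) is exactly spc4.S31 over `Type`**: given
`nonempty_diffeomorph_sphere_three.{0}`, a closed connected smooth `M : Type` with `π₁(M, x)` free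
of rank `0` is simply connected (§1), hence `M ≅ S³`, i.e. `IsSphereTwoProdCircleSum 0 M`
(`isSphereTwoProdCircleSum_zero_iff`; the orientability hypothesis is not needed).  So (H53) splits
as S31 (`k = 0`) plus its genus-`≥ 1` part, the latter being classical `3`-manifold topology
(Kneser–Stallings, Hempel 5.2) modulo S31 for the homotopy-sphere summands.
[cite: MorganTian2007, Cor. 0.2 (a)] [cite: Hempel1976, Thm. 5.3] -/
theorem isSphereTwoProdCircleSum_zero_of_sphere_three (h3 : nonempty_diffeomorph_sphere_three.{0})
    (M : Type) [TopologicalSpace M] [T2Space M] [SecondCountableTopology M]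
    [ChartedSpace (EuclideanSpace ℝ (Fin 3)) M] [IsManifold (𝓡 3) ∞ M] [CompactSpace M]
    [ConnectedSpace M] (x : M) (hx : IsFreeOfRank (FundamentalGroup M x) 0) :
    IsSphereTwoProdCircleSum 0 M := by
  haveI : SimplyConnectedSpace M :=
    simplyConnectedSpace_of_isFreeOfRank_fundamentalGroup_zero (𝓡 3) hx
  exact (isSphereTwoProdCircleSum_zero_iff M).2 (h3 M)

end Literature.Topology.FourManifolds

end
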